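import Summits.PneNP.PneNP.Theorems.ChebyshevTracialDesignPairContainmentEntrywise
import HarnessLib

/-!
# Cell pnp-psdrank, route `ChebyshevTracialDesign`: (CG_1′) FOR EVERY MASK IN EVERY VERTEX-SPARSE DIRECTION FIELD — `M`-dependent, sign-incoherent
# directions supported on a fixed set `S` of vertices are priced for ALL masks by the `r = 1` rung, at cost `|S|²·(2n)^{|S|}·γ`
# (crux `TracialDecayExp20`, stmt-PneNP-19878)

Brick 166 (prover g32; MEMO-35 §3). Brick 102 (`…PairContainmentEntrywise`) prices the pair-containment form `Q^f_M(v) = Σ_U W(U,M) f(U) C_v(U)²`,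
`C_v(U) = Σ_p v_p x_p x_{π_M p}`, on the SIGN-COHERENT cone (`v_M ≥ 0`) by expanding `C_v²` into the `n²` pair-pinned cells, each a `[0,1]`-weighted
rectangle for the `r = 1` rung; for sign-incoherent directions the pair expansion has signed coefficients and the argument stops (MEMO-22 §1(b):
«an entrywise-nonnegative matrix need not be psd»). OBSERVATION: refine pairs to ATOMS. For a field supported on a vertex set `S` (`v_M(p) = 0` off
`S`), `C_{v_M}(U)²` is a NONNEGATIVE function of the full/not-full pattern `τ_U ∈ {0,1}^S` (`τ_U(r) = x_r x_{π_M r}`), hence a nonnegative combination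
`Σ_τ c_τ(M)²·1[τ_U = τ]` of the `2^{|S|}` atom indicators, `c_τ(M) = Σ_{r : τ(r)} v_M(r)`, `c_τ² ≤ |S|²`; and after naming the partners
`σ = π_M|_S` (`n^{|S|}` choices) each atom is a genuine `[0,1]`-weighted RECTANGLE `(f·1[pattern (τ,σ) at U]) × 1[σ ⊆ M]`. So the `r = 1` rung for
all rectangles prices every `S`-supported field — `M`-DEPENDENT and SIGN-INCOHERENT — for EVERY mask `0 ≤ f ≤ 1`:
* §1 atoms: `prod_edgeIndicator_eq` (`Π_{r∈S} 1[{r,σ(r)} ∈ M] = 1[σ = π_M|_S]`), `prod_patternIndicator_eq`, `containment_sq_eq_sum_atoms`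
  (`C_{v_M}(U)² = Σ_τ Σ_σ c_τ(M)²·a_{τσ}(U)·b_σ(M)`), `atomCoeff_sq_le` (`c_τ(M)² ≤ |S|²`).
* §2 **`sum_posPart_containment_le_of_support`** — for ANY weight `W` whose mass on every 0/1 rectangle is `≤ γ`, every vertex set `S`, every mask
  `0 ≤ f ≤ 1` and every field `|v_M(p)| ≤ 1` supported on `S`: `Σ_M (Σ_U W(U,M) f(U) C_{v_M}(U)²)₊ ≤ |S|²·(2n)^{|S|}·γ` — the literal (CG_1′) on
  the class of `S`-supported fields; **`perCut_posPart_le_of_support`** — the per-cut form (brick 165's (PC) on that class):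
  `Σ_U (Σ_M W(U,M) C_{v_M}(U)²)₊ ≤ |S|²·(2n)^{|S|}·γ`.
* §3 **`sparseField_containment_decay`** — UNCONDITIONAL for the route's designs (`γ = 20·e^{−a·dq n}` by `rectangleDecayExp_all_holds`): for some
  `a > 0` and all large even `n`, every balanced `B = 20` Chebyshev design, every `S`, every mask `f : cuts → [0,1]` and every `S`-supported field
  `|v_M| ≤ 1`: `Σ_M (Q^f_M(v_M))₊ ≤ |S|²·(2n)^{|S|}·20·e^{−a·dq n}` — exponentially small while `|S| ≤ a·dq n/(2·ln(2n))`.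
READING. In the amplitude-one rung the direction fields generated by a degree-one factor `B_U = Σ_p x_p β_p` live on the support of `β`; so with
the `S`-supported versions of bricks 101/106/108 (not formalised here) this prices `𝒜₁`-strategies `X_U = f(U)·B_UB_Uᵀ` with a VERTEX-SPARSE factor
and an ARBITRARY (spread) mask `f`. Together with bricks 104/164/164b (fields of low matching-degree / window-local, all masks) and 113–163 (junta
masks, all fields) the open heart of (CG_1′) is: DENSELY supported, sign-incoherent, `M`-adapted fields against spread masks (brick 165: per-cut
virtual nonpositivity for `M`-global fields). [cite: Rothvoss2017, §2 and Lemma 7 (PDF pp. 6–8)] [cite: KeevashLifshitz2023, Thm. 1.8]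
[cite: GriblingDelaatLaurent2019, §5] [cite: Grigoriev2001, Lemma 1.4 (PDF p. 8)]
Stature: support/instrument (kernel lane, no defs, axioms standard; a priced sub-class of direction fields, cost exponential in the support size).
WHAT THIS IS NOT: nothing on densely supported fields, no proof or refutation of `TracialDecayExp20`, nothing on psd rank of P_PM(K_n) beyond the
rungs, no P-vs-NP content. Supports stmt-PneNP-19878.
-/

set_option linter.dupNamespace false -- `Summit.PneNP.PneNP.…`: summit = sub-problem (D-0017)

noncomputable section

namespace Summit.PneNP.PneNP.Theorems.ChebyshevTracialDesignPairContainmentSparseFields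

open Finset Literature.Barriers.PneNP Literature.Combinatorics.Optimization
open Summit.PneNP.PneNP.Theorems.ChebyshevTracialDesignPairContainmentEntrywise (sum_posPart_mul_le_of_rectangles posPart_sum_le
  rectBound_nonneg)
open Summit.PneNP.PneNP.Theorems.ChebyshevTracialDesignUnconditionalRungs (rectangleDecayExp_all_holds)

variable {n : ℕ}

/-! ### §1 Atoms of the full/not-full pattern on a vertex set -/

/-- **The matching-side atom**: `Π_{r ∈ S} 1[{r, σ(r)} ∈ M] = 1[σ = π_M|_S]`. [folklore] -/
theorem prod_edgeIndicator_eq (S : Finset (Fin n)) (M : PMatch n) (σ : S → Fin n) :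
    ∏ r : S, (if s(r.1, σ r) ∈ M.1 then (1 : ℝ) else 0) = if σ = (fun r : S => M.2.partner r.1) then 1 else 0 := by
  classical
  rw [Finset.prod_boole]
  congr 1
  apply propext
  constructor
  · intro h
    funext r
    exact M.2.eq_partner_of_mem (h r (mem_univ _))
  · intro h r _
    rw [h]
    exact M.2.mk_partner_mem r.1

/-- **The cut-side atom**: `Π_{r ∈ S} 1[τ(r) = (x_r x_{σ(r)})(U)] = 1[τ = τ_U^σ]` with `τ_U^σ(r) = 1[r ∈ U ∧ σ(r) ∈ U]`. [folklore] -/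
theorem prod_patternIndicator_eq (S : Finset (Fin n)) (U : OddSet n) (σ : S → Fin n) (τ : S → Bool) :
    ∏ r : S, (if τ r = decide (r.1 ∈ U.1 ∧ σ r ∈ U.1) then (1 : ℝ) else 0) =
      if τ = (fun r : S => decide (r.1 ∈ U.1 ∧ σ r ∈ U.1)) then 1 else 0 := by
  classical
  rw [Finset.prod_boole]
  congr 1
  apply propext
  constructor
  · intro h
    funext r
    exact h r (mem_univ _)
  · intro h r _
    rw [h]

/-- The atom coefficient `c_τ(M) = Σ_{r : τ(r)} v_M(r)` has `c_τ(M)² ≤ |S|²` for `|v_M| ≤ 1`. [folklore] -/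
theorem atomCoeff_sq_le (S : Finset (Fin n)) (v : Fin n → ℝ) (hv : ∀ p, |v p| ≤ 1) (τ : S → Bool) :
    (∑ r : S, if τ r then v r.1 else 0) ^ 2 ≤ (S.card : ℝ) ^ 2 := by
  classical
  have h1 : |∑ r : S, (if τ r then v r.1 else 0)| ≤ S.card := by
    calc |∑ r : S, (if τ r then v r.1 else 0)| ≤ ∑ r : S, |(if τ r then v r.1 else 0)| := abs_sum_le_sum_abs _ _
      _ ≤ ∑ _r : S, (1 : ℝ) := sum_le_sum fun r _ => by
          split_ifs
          · exact hv r.1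
          · simp
      _ = S.card := by simp
  have h0 : (0 : ℝ) ≤ S.card := Nat.cast_nonneg _
  rw [← sq_abs]
  exact pow_le_pow_left₀ (abs_nonneg _) h1 2

/-- **THE ATOM EXPANSION OF THE SQUARED CONTAINMENT FORM.** For a direction `v_M` supported on `S`:
`C_{v_M}(U)² = Σ_τ Σ_σ c_τ(M)²·(Π_{r∈S} 1[τ(r) = x_rx_{σ(r)}(U)])·(Π_{r∈S} 1[{r,σ(r)} ∈ M])` (`τ : S → Bool`, `σ : S → [n]`): only the atom
`σ = π_M|_S`, `τ = ` the full/not-full pattern of `U` survives, and there `c_τ(M) = C_{v_M}(U)`. [cite: Rothvoss2017, §2 (PDF p. 6)] -/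
theorem containment_sq_eq_sum_atoms (S : Finset (Fin n)) (U : OddSet n) (M : PMatch n) (v : Fin n → ℝ)
    (hvS : ∀ p, p ∉ S → v p = 0) :
    (∑ p, v p * ((if p ∈ U.1 then (1 : ℝ) else 0) * (if M.2.partner p ∈ U.1 then (1 : ℝ) else 0))) ^ 2 =
      ∑ τ : S → Bool, ∑ σ : S → Fin n, (∑ r : S, if τ r then v r.1 else 0) ^ 2 *
        ((∏ r : S, (if τ r = decide (r.1 ∈ U.1 ∧ σ r ∈ U.1) then (1 : ℝ) else 0)) *
          (∏ r : S, (if s(r.1, σ r) ∈ M.1 then (1 : ℝ) else 0))) := by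
  classical
  -- the matching-side atom selects `σ = π_M|_S`
  simp_rw [prod_edgeIndicator_eq, prod_patternIndicator_eq]
  have hσ : ∀ τ : S → Bool, ∑ σ : S → Fin n, (∑ r : S, if τ r then v r.1 else 0) ^ 2 *
      ((if τ = (fun r : S => decide (r.1 ∈ U.1 ∧ σ r ∈ U.1)) then (1 : ℝ) else 0) *
        (if σ = (fun r : S => M.2.partner r.1) then (1 : ℝ) else 0)) =
      (∑ r : S, if τ r then v r.1 else 0) ^ 2 *
        (if τ = (fun r : S => decide (r.1 ∈ U.1 ∧ M.2.partner r.1 ∈ U.1)) then (1 : ℝ) else 0) := by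
    intro τ
    have : ∀ σ : S → Fin n, (∑ r : S, if τ r then v r.1 else 0) ^ 2 *
        ((if τ = (fun r : S => decide (r.1 ∈ U.1 ∧ σ r ∈ U.1)) then (1 : ℝ) else 0) *
          (if σ = (fun r : S => M.2.partner r.1) then (1 : ℝ) else 0)) =
        if σ = (fun r : S => M.2.partner r.1) then (∑ r : S, if τ r then v r.1 else 0) ^ 2 *
          (if τ = (fun r : S => decide (r.1 ∈ U.1 ∧ σ r ∈ U.1)) then (1 : ℝ) else 0) else 0 := fun σ => by
      split_ifs <;> ring
    simp_rw [this]
    rw [Finset.sum_ite_eq' univ (fun r : S => M.2.partner r.1), if_pos (mem_univ _)]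
  simp_rw [hσ]
  -- the cut-side atom selects the pattern of `U`
  have hτ : ∀ τ : S → Bool, (∑ r : S, if τ r then v r.1 else 0) ^ 2 *
      (if τ = (fun r : S => decide (r.1 ∈ U.1 ∧ M.2.partner r.1 ∈ U.1)) then (1 : ℝ) else 0) =
      if τ = (fun r : S => decide (r.1 ∈ U.1 ∧ M.2.partner r.1 ∈ U.1)) then
        (∑ r : S, if τ r then v r.1 else 0) ^ 2 else 0 := fun τ => by split_ifs <;> ring
  simp_rw [hτ]
  rw [Finset.sum_ite_eq' univ (fun r : S => decide (r.1 ∈ U.1 ∧ M.2.partner r.1 ∈ U.1)), if_pos (mem_univ _)]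
  -- on that atom the coefficient is the containment form
  congr 1
  have hS : ∑ p, v p * ((if p ∈ U.1 then (1 : ℝ) else 0) * (if M.2.partner p ∈ U.1 then (1 : ℝ) else 0)) =
      ∑ p ∈ S, v p * ((if p ∈ U.1 then (1 : ℝ) else 0) * (if M.2.partner p ∈ U.1 then (1 : ℝ) else 0)) := by
    rw [← Finset.sum_subset (Finset.subset_univ S)]
    intro p _ hp
    rw [hvS p hp, zero_mul]
  rw [hS, ← Finset.sum_coe_sort S]
  refine sum_congr rfl fun r _ => ?_
  by_cases h1 : r.1 ∈ U.1 <;> by_cases h2 : M.2.partner r.1 ∈ U.1 <;> simp [h1, h2]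

/-! ### §2 (CG_1′) and its per-cut form on vertex-sparse fields, for any weight with an all-rectangle bound -/

/-- **(CG_1′) FOR EVERY MASK IN EVERY `S`-SUPPORTED DIRECTION FIELD.** Let `W` be any weight whose mass on every 0/1 rectangle of odd cuts ×
perfect matchings is `≤ γ`. Then for every vertex set `S`, every mask `0 ≤ f ≤ 1` and every field `v : PMatch n → (Fin n → ℝ)` with `|v_M(p)| ≤ 1`
and `v_M(p) = 0` for `p ∉ S` (arbitrarily `M`-dependent and sign-incoherent ON `S`):
`Σ_M (Σ_U W(U,M)·f(U)·(Σ_p v_M(p) x_p x_{π_M p})²)₊ ≤ |S|²·(2n)^{|S|}·γ`.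
[cite: Rothvoss2017, §2 and Lemma 7 (PDF pp. 6–8)] [cite: GriblingDelaatLaurent2019, §5] -/
theorem sum_posPart_containment_le_of_support (W : OddSet n → PMatch n → ℝ) {γ : ℝ}
    (hR : ∀ (A : Finset (OddSet n)) (B : Finset (PMatch n)), ∑ U ∈ A, ∑ M ∈ B, W U M ≤ γ)
    (S : Finset (Fin n)) (f : OddSet n → ℝ) (hf : ∀ U, 0 ≤ f U ∧ f U ≤ 1)
    (v : PMatch n → Fin n → ℝ) (hv1 : ∀ M p, |v M p| ≤ 1) (hvS : ∀ M p, p ∉ S → v M p = 0) :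
    ∑ M : PMatch n, max (∑ U : OddSet n, W U M *
        (f U * (∑ p, v M p * ((if p ∈ U.1 then (1 : ℝ) else 0) * (if M.2.partner p ∈ U.1 then (1 : ℝ) else 0))) ^ 2)) 0 ≤
      (S.card : ℝ) ^ 2 * (2 * (n : ℝ)) ^ S.card * γ := by
  classical
  have hγ : 0 ≤ γ := rectBound_nonneg W hR
  -- atoms
  set a : (S → Bool) → (S → Fin n) → OddSet n → ℝ := fun τ σ U =>
    ∏ r : S, (if τ r = decide (r.1 ∈ U.1 ∧ σ r ∈ U.1) then (1 : ℝ) else 0) with ha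
  set b : (S → Fin n) → PMatch n → ℝ := fun σ M => ∏ r : S, (if s(r.1, σ r) ∈ M.1 then (1 : ℝ) else 0) with hb
  set c : (S → Bool) → PMatch n → ℝ := fun τ M => ∑ r : S, if τ r then v M r.1 else 0 with hc
  have ha01 : ∀ τ σ U, 0 ≤ a τ σ U ∧ a τ σ U ≤ 1 := fun τ σ U => by
    simp only [ha, prod_patternIndicator_eq]
    split_ifs <;> norm_num
  have hb01 : ∀ σ M, 0 ≤ b σ M ∧ b σ M ≤ 1 := fun σ M => by
    simp only [hb, prod_edgeIndicator_eq]
    split_ifs <;> norm_num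
  have hfa : ∀ τ σ U, 0 ≤ f U * a τ σ U ∧ f U * a τ σ U ≤ 1 := fun τ σ U =>
    ⟨mul_nonneg (hf U).1 (ha01 τ σ U).1, by nlinarith [(hf U).1, (hf U).2, (ha01 τ σ U).1, (ha01 τ σ U).2]⟩
  have hc2 : ∀ τ M, c τ M ^ 2 ≤ (S.card : ℝ) ^ 2 := fun τ M => atomCoeff_sq_le S (v M) (hv1 M) τ
  -- per matching: the value as a sum over atoms
  set T : (S → Bool) → (S → Fin n) → PMatch n → ℝ := fun τ σ M => ∑ U : OddSet n, W U M * (f U * a τ σ U) with hT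
  have hQ : ∀ M : PMatch n, ∑ U : OddSet n, W U M *
      (f U * (∑ p, v M p * ((if p ∈ U.1 then (1 : ℝ) else 0) * (if M.2.partner p ∈ U.1 then (1 : ℝ) else 0))) ^ 2) =
      ∑ τ : S → Bool, ∑ σ : S → Fin n, c τ M ^ 2 * (b σ M * T τ σ M) := by
    intro M
    have h1 : ∀ U : OddSet n, W U M *
        (f U * (∑ p, v M p * ((if p ∈ U.1 then (1 : ℝ) else 0) * (if M.2.partner p ∈ U.1 then (1 : ℝ) else 0))) ^ 2) =
        ∑ τ : S → Bool, ∑ σ : S → Fin n, c τ M ^ 2 * (b σ M * (W U M * (f U * a τ σ U))) := by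
      intro U
      rw [containment_sq_eq_sum_atoms S U M (v M) (hvS M), mul_sum, mul_sum]
      refine sum_congr rfl fun τ _ => ?_
      rw [mul_sum, mul_sum]
      refine sum_congr rfl fun σ _ => ?_
      simp only [ha, hb, hc]
      ring
    simp_rw [h1]
    rw [sum_comm]
    refine sum_congr rfl fun τ _ => ?_
    rw [sum_comm]
    refine sum_congr rfl fun σ _ => ?_
    rw [hT]
    simp only [mul_sum]
  -- positive parts, atom by atom
  have hpos : ∀ M : PMatch n, max (∑ U : OddSet n, W U M *
      (f U * (∑ p, v M p * ((if p ∈ U.1 then (1 : ℝ) else 0) * (if M.2.partner p ∈ U.1 then (1 : ℝ) else 0))) ^ 2)) 0 ≤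
      ∑ τ : S → Bool, ∑ σ : S → Fin n, (S.card : ℝ) ^ 2 * max (b σ M * T τ σ M) 0 := by
    intro M
    rw [hQ M]
    refine (posPart_sum_le _ _).trans (sum_le_sum fun τ _ => (posPart_sum_le _ _).trans (sum_le_sum fun σ _ => ?_))
    have hc0 : 0 ≤ c τ M ^ 2 := sq_nonneg _
    have hsplit : max (c τ M ^ 2 * (b σ M * T τ σ M)) 0 = c τ M ^ 2 * max (b σ M * T τ σ M) 0 := by
      rcases le_or_gt 0 (b σ M * T τ σ M) with h | h
      · rw [max_eq_left h, max_eq_left (mul_nonneg hc0 h)]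
      · rw [max_eq_right h.le, mul_zero, max_eq_right (mul_nonpos_of_nonneg_of_nonpos hc0 h.le)]
    rw [hsplit]
    exact mul_le_mul_of_nonneg_right (hc2 τ M) (le_max_right _ _)
  -- sum over the matchings: each atom is a `[0,1]`-weighted rectangle
  have hatom : ∀ (τ : S → Bool) (σ : S → Fin n), ∑ M : PMatch n, max (b σ M * T τ σ M) 0 ≤ γ := fun τ σ =>
    sum_posPart_mul_le_of_rectangles W hR (fun U => f U * a τ σ U) (hfa τ σ) (b σ) (hb01 σ)
  calc ∑ M : PMatch n, max (∑ U : OddSet n, W U M *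
          (f U * (∑ p, v M p * ((if p ∈ U.1 then (1 : ℝ) else 0) * (if M.2.partner p ∈ U.1 then (1 : ℝ) else 0))) ^ 2)) 0
      ≤ ∑ M : PMatch n, ∑ τ : S → Bool, ∑ σ : S → Fin n, (S.card : ℝ) ^ 2 * max (b σ M * T τ σ M) 0 := sum_le_sum fun M _ => hpos M
    _ = ∑ τ : S → Bool, ∑ σ : S → Fin n, (S.card : ℝ) ^ 2 * ∑ M : PMatch n, max (b σ M * T τ σ M) 0 := by
        rw [sum_comm]
        refine sum_congr rfl fun τ _ => ?_
        rw [sum_comm]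
        refine sum_congr rfl fun σ _ => ?_
        rw [mul_sum]
    _ ≤ ∑ _τ : S → Bool, ∑ _σ : S → Fin n, (S.card : ℝ) ^ 2 * γ :=
        sum_le_sum fun τ _ => sum_le_sum fun σ _ => mul_le_mul_of_nonneg_left (hatom τ σ) (sq_nonneg _)
    _ = (S.card : ℝ) ^ 2 * (2 * (n : ℝ)) ^ S.card * γ := by
        simp only [sum_const, card_univ, nsmul_eq_mul, Fintype.card_fun, Fintype.card_bool, Fintype.card_coe, Fintype.card_fin]
        push_cast
        ring

/-- **THE PER-CUT FORM ON `S`-SUPPORTED FIELDS** (brick 165's (PC) restricted to the class): under the same all-rectangle bound, every field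
`|v_M| ≤ 1` supported on `S` has total positive per-cut value `Σ_U (Σ_M W(U,M)·(Σ_p v_M(p) x_p x_{π_M p})²)₊ ≤ |S|²·(2n)^{|S|}·γ`
(test the mask `1[per-cut value ≥ 0]`). [cite: Rothvoss2017, §2 and Lemma 7 (PDF pp. 6–8)] [cite: GriblingDelaatLaurent2019, §5] -/
theorem perCut_posPart_le_of_support (W : OddSet n → PMatch n → ℝ) {γ : ℝ}
    (hR : ∀ (A : Finset (OddSet n)) (B : Finset (PMatch n)), ∑ U ∈ A, ∑ M ∈ B, W U M ≤ γ)
    (S : Finset (Fin n)) (v : PMatch n → Fin n → ℝ) (hv1 : ∀ M p, |v M p| ≤ 1) (hvS : ∀ M p, p ∉ S → v M p = 0) :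
    ∑ U : OddSet n, max (∑ M : PMatch n, W U M *
        (∑ p, v M p * ((if p ∈ U.1 then (1 : ℝ) else 0) * (if M.2.partner p ∈ U.1 then (1 : ℝ) else 0))) ^ 2) 0 ≤
      (S.card : ℝ) ^ 2 * (2 * (n : ℝ)) ^ S.card * γ := by
  classical
  set g : OddSet n → ℝ := fun U => ∑ M : PMatch n, W U M *
      (∑ p, v M p * ((if p ∈ U.1 then (1 : ℝ) else 0) * (if M.2.partner p ∈ U.1 then (1 : ℝ) else 0))) ^ 2 with hg
  set f : OddSet n → ℝ := fun U => if 0 ≤ g U then 1 else 0 with hf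
  have hf01 : ∀ U, 0 ≤ f U ∧ f U ≤ 1 := fun U => by simp only [hf]; split_ifs <;> norm_num
  have hfg : ∀ U, f U * g U = max (g U) 0 := fun U => by
    simp only [hf]
    by_cases h : 0 ≤ g U
    · rw [if_pos h, max_eq_left h, one_mul]
    · rw [if_neg h, max_eq_right (le_of_lt (lt_of_not_ge h)), zero_mul]
  have hswap : ∑ M : PMatch n, ∑ U : OddSet n, W U M *
      (f U * (∑ p, v M p * ((if p ∈ U.1 then (1 : ℝ) else 0) * (if M.2.partner p ∈ U.1 then (1 : ℝ) else 0))) ^ 2) =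
      ∑ U : OddSet n, f U * g U := by
    rw [sum_comm]
    refine sum_congr rfl fun U _ => ?_
    rw [hg, mul_sum]
    refine sum_congr rfl fun M _ => ?_
    ring
  have key := sum_posPart_containment_le_of_support W hR S f hf01 v hv1 hvS
  calc ∑ U : OddSet n, max (g U) 0 = ∑ U : OddSet n, f U * g U := sum_congr rfl fun U _ => (hfg U).symm
    _ = ∑ M : PMatch n, ∑ U : OddSet n, W U M *
          (f U * (∑ p, v M p * ((if p ∈ U.1 then (1 : ℝ) else 0) * (if M.2.partner p ∈ U.1 then (1 : ℝ) else 0))) ^ 2) :=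
        hswap.symm
    _ ≤ ∑ M : PMatch n, max (∑ U : OddSet n, W U M *
          (f U * (∑ p, v M p * ((if p ∈ U.1 then (1 : ℝ) else 0) * (if M.2.partner p ∈ U.1 then (1 : ℝ) else 0))) ^ 2)) 0 :=
        sum_le_sum fun M _ => le_max_left _ _
    _ ≤ (S.card : ℝ) ^ 2 * (2 * (n : ℝ)) ^ S.card * γ := key

/-! ### §3 The design corollary (unconditional) -/

/-- **(CG_1′) FOR EVERY MASK IN EVERY VERTEX-SPARSE FIELD, for balanced Chebyshev designs — UNCONDITIONAL.** For some `a > 0` and all large even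
`n`: every balanced exact design `(t, C, w)` of degree `dq n` on levels `≤ Tq n` with `Σ|w_c| ≤ 20`, every vertex set `S`, every mask
`f : cuts → [0,1]` and every direction field `|v_M(p)| ≤ 1` supported on `S` satisfy
`Σ_M (Σ_U W(U,M)·f(U)·(Σ_p v_M(p) x_p x_{π_M p})²)₊ ≤ |S|²·(2n)^{|S|}·20·exp(−a·dq n)`.
[cite: Rothvoss2017, §2 and Lemma 7 (PDF pp. 6–8)] [cite: KeevashLifshitz2023, Thm. 1.8] [cite: GriblingDelaatLaurent2019, §5] -/
theorem sparseField_containment_decay :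
    ∃ a : ℝ, 0 < a ∧ ∃ n₁ : ℕ, ∀ n : ℕ, n₁ ≤ n → Even n → ∀ (t : ℕ) (C : Finset ℕ) (w : ℕ → ℝ),
      IsBalancedDesign n t (Tq n) (dq n) 20 C w → ∀ (S : Finset (Fin n)) (f : OddSet n → ℝ), (∀ U, 0 ≤ f U ∧ f U ≤ 1) →
        ∀ v : PMatch n → Fin n → ℝ, (∀ M p, |v M p| ≤ 1) → (∀ M p, p ∉ S → v M p = 0) →
          ∑ M : PMatch n, max (∑ U : OddSet n, levelWeight n t C w U M *
            (f U * (∑ p, v M p * ((if p ∈ U.1 then (1 : ℝ) else 0) * (if M.2.partner p ∈ U.1 then (1 : ℝ) else 0))) ^ 2)) 0 ≤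
          (S.card : ℝ) ^ 2 * (2 * (n : ℝ)) ^ S.card * (20 * Real.exp (-(a * (dq n : ℝ)))) := by
  obtain ⟨a, ha, n₁, h⟩ := rectangleDecayExp_all_holds
  exact ⟨a, ha, n₁, fun n hn hev t C w hdes S f hf v hv hvS =>
    sum_posPart_containment_le_of_support _ (h n hn hev t C w hdes) S f hf v hv hvS⟩

/-- **The per-cut form on vertex-sparse fields, for balanced Chebyshev designs — UNCONDITIONAL.**
[cite: Rothvoss2017, §2 and Lemma 7 (PDF pp. 6–8)] [cite: KeevashLifshitz2023, Thm. 1.8] -/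
theorem sparseField_perCut_decay :
    ∃ a : ℝ, 0 < a ∧ ∃ n₁ : ℕ, ∀ n : ℕ, n₁ ≤ n → Even n → ∀ (t : ℕ) (C : Finset ℕ) (w : ℕ → ℝ),
      IsBalancedDesign n t (Tq n) (dq n) 20 C w → ∀ (S : Finset (Fin n)),
        ∀ v : PMatch n → Fin n → ℝ, (∀ M p, |v M p| ≤ 1) → (∀ M p, p ∉ S → v M p = 0) →
          ∑ U : OddSet n, max (∑ M : PMatch n, levelWeight n t C w U M *
            (∑ p, v M p * ((if p ∈ U.1 then (1 : ℝ) else 0) * (if M.2.partner p ∈ U.1 then (1 : ℝ) else 0))) ^ 2) 0 ≤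
          (S.card : ℝ) ^ 2 * (2 * (n : ℝ)) ^ S.card * (20 * Real.exp (-(a * (dq n : ℝ)))) := by
  obtain ⟨a, ha, n₁, h⟩ := rectangleDecayExp_all_holds
  exact ⟨a, ha, n₁, fun n hn hev t C w hdes S v hv hvS =>
    perCut_posPart_le_of_support _ (h n hn hev t C w hdes) S v hv hvS⟩

end Summit.PneNP.PneNP.Theorems.ChebyshevTracialDesignPairContainmentSparseFields
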